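import Mathlib
import Summits.KontsevichZagierPeriods.Zeta5Search.DenomLaw.Profile18bPath
import Summits.KontsevichZagierPeriods.Zeta5Search.DenomLaw.ZeroPointCoverKit
import HarnessLib

/-!
# ζ(5) search — the `N_p = 18` PROFILE with short blocks `(1,2), (1,3), (2,3)` at `3p ≤ d`: the ZERO-POINT law `−9` for EVERY sorted parameter vector ⇒ PATH accounting on the WHOLE profile

Cell `pub-zeta5` (HONEST FRAMING: systematic search; no irrationality claim unless certified), TRACK «DENOM-LAW» D1 prover seat
(denom-prover-d1 g18, `HOME/denom-law/prover-d1/ATTEMPT-18.md` §2).  Gen 17's `DenomLaw/Profile18bPath` proves the node `DenomLaw.PathAccountingFirstPeriod`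
on this profile (`p ≤ b₇`, `b₀ − b₂ − b₃ < p ≤ b₀ − b₁ − b₄` inside the first period; `N_p = 18`) below `d = 3p` by the Lemma-D bonus `−10`, and left the cell
`3p ≤ d` open (node `−9`; 32 of 7,193 instances at `p ≤ 11`, exact `v = −9`, «a casLB + 2 on the conjugate-pair configuration at m = −7»).  Gen 18's global
census identifies the rung: at `3p ≤ d` NO class has exponent `−8` and the classes of exponent `−7` are the single conjugate pair `[1,−6,−3,1]` / `[1,−3,−6,1]`
(on both landed covers `FullProfile.cover18b_ev / cover18b_od`, by `decide`), i.e. the ONE-POINT zero window `(8; D = [], S = T1Rays.Sz8)`; with the degree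
condition `6p ≤ 2d + 1` the ZERO-POINT type-space law (`ResidueLaw.typeSpaceLawZeroPoint_holds`, through `DenomLaw.zeroPoint_ZP8S`) gives
**`v_p(Cas_j(b)) ≥ 7 − 2M = −9`** (`cas_ge18b_neg9`, every `j`).  Hence the node on the WHOLE profile: **`pathAccounting_profile18b_all`** (every `j`) and
**`pathAccountingFirstPeriod_profile18b_all`** (binders VERBATIM plus the three profile inequalities, no hypothesis on `d`).  MODEL/structure-side valuation
bookkeeping of the cell's own rationals; nothing about ζ(5); no γ; records in print UNMOVED.
-/

open Finset

namespace Summit.KontsevichZagierPeriods.Zeta5Search.FullProfile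

open Summit.KontsevichZagierPeriods.Zeta5Search.ClusterValuation
open Summit.KontsevichZagierPeriods.Zeta5Search.CasoratianValuation (InPolytope shift casoratian pairFloors refund)
open Summit.KontsevichZagierPeriods.Zeta5Search.WedgeDictionary (dOf)
open Summit.KontsevichZagierPeriods.Zeta5Search.ClassTypeCover
open Summit.KontsevichZagierPeriods.Zeta5Search.DenomLaw (cStar FirstPeriod Sorted7 zeroClasses_of_cover zeroPoint_ZP8S)
open Summit.KontsevichZagierPeriods.Zeta5Search.ZeroWindows (ZeroWindowClasses)
open Summit.KontsevichZagierPeriods.Zeta5Search.DenomLaw.FirstPeriodKit (cStar_le_eleven sorted7_chain)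
open Summit.KontsevichZagierPeriods.Zeta5Search.SortedProfile

section Bounds

variable {b : ℕ → ℤ} {j p : ℕ}

/-- **The ZERO-POINT law on this profile at `3p ≤ d`, general `b`**: `v_p(Cas_j(b)) ≥ −9 = 7 − 2M` at `M = 8` — no class of exponent `−8`, the live layer
`−7` is the one conjugate pair `[1,−6,−3,1]` / `[1,−3,−6,1]`: ONE orbit point (`DenomLaw.zeroPoint_ZP8S`). -/
theorem cas_ge18b_neg9 (hb : InPolytope b) (hs : Sorted7 b) (hbj : InPolytope (shift b j)) (hj1 : 1 ≤ j) (hj7 : j ≤ 7)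
    (hprime : p.Prime) (hp5 : 5 ≤ p) (hwin : (b 0 + 2 : ℤ) < (p : ℤ) ^ 2) (hP : (p : ℤ) ≤ b 7) (hQ : b 0 < (p : ℤ) + b 2 + b 3)
    (hQ4 : (p : ℤ) + b 1 + b 4 ≤ b 0) (hF1 : b 1 < 2 * (p : ℤ)) (hF2 : b 0 < 2 * (p : ℤ) + b 6 + b 7)
    (hd : 3 * (p : ℤ) ≤ dOf b) (hcas : casoratian b j ≠ 0) : (-9 : ℤ) ≤ padicValRat p (casoratian b j) := by
  haveI : Fact p.Prime := ⟨hprime⟩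
  have hp2 : p % 2 = 1 := Nat.odd_iff.1 (hprime.odd_of_ne_two (by omega))
  obtain ⟨h0, hb1, hb2, hb3, hb4, -, -, -, -⟩ := box hb
  have hpb : (p : ℤ) ≤ b 0 := by linarith
  have hdeg : (p : ℤ) * 6 ≤ 2 * dOf b + 1 := by linarith
  have hC : ZeroWindowClasses b p 8 [] T1Rays.Sz8 := by
    rcases Int.emod_two_eq_zero_or_one (b 0) with hr | hr
    · exact zeroClasses_of_cover h0 (cover18b_ev hb hs hP hQ hQ4 hF1 hF2 hp5 hp2 hr) (by rw [oddFlag_false hr]; decide)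
    · exact zeroClasses_of_cover h0 (cover18b_od hb hs hP hQ hQ4 hF1 hF2 hp5 hp2 hr) (by rw [oddFlag_true hr]; decide)
  exact zeroPoint_ZP8S hb hbj hj1 hj7 hprime hp5 hpb hwin hC hdeg hcas

end Bounds

/-- **`PathAccountingFirstPeriod`'s conclusion on the WHOLE `N_p = 18` profile with short blocks `(1,2), (1,3), (2,3)`, EVERY sorted `b`, every direction
`j`** (gen 17's `pathAccounting_profile18b` below `3p`, the zero-point law at `3p ≤ d`). -/
theorem pathAccounting_profile18b_all (b : ℕ → ℤ) (j p : ℕ) (hb : InPolytope b) (hs : Sorted7 b) (hbj : InPolytope (shift b j))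
    (hj1 : 1 ≤ j) (hj7 : j ≤ 7) (hprime : p.Prime) (hp5 : 5 ≤ p) (hwin : (b 0 + 2 : ℤ) < (p : ℤ) ^ 2) (hfp : FirstPeriod b p)
    (hP : (p : ℤ) ≤ b 7) (hQ : b 0 < (p : ℤ) + b 2 + b 3) (hQ4 : (p : ℤ) + b 1 + b 4 ≤ b 0) (hcas : casoratian b j ≠ 0) :
    dOf b / (p : ℤ) - pairFloors b p - min (if 2 ≤ dOf b / (p : ℤ) then (1 : ℤ) else 0) (5 - (cStar b p : ℤ))
      ≤ padicValRat p (casoratian b j) := by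
  by_cases h3 : 3 * (p : ℤ) ≤ dOf b
  · obtain ⟨hF1, hF2⟩ := fp_bounds hfp
    have hp0 : (0 : ℤ) < p := by exact_mod_cast hprime.pos
    rw [pairFloors_eq_18b hb hs hprime.pos hQ hQ4 hfp]
    have hC11 : (cStar b p : ℤ) ≤ 11 := by exact_mod_cast cStar_le_eleven b p
    have hmin : -6 ≤ min (if 2 ≤ dOf b / (p : ℤ) then (1 : ℤ) else 0) (5 - (cStar b p : ℤ)) :=
      le_min (by split_ifs <;> norm_num) (by linarith)
    obtain ⟨-, hd4⟩ := d_bounds18b hs hP hQ hQ4 hF1 hF2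
    have hfd : dOf b / (p : ℤ) < 4 := by rw [Int.ediv_lt_iff_lt_mul hp0]; linarith
    linarith [cas_ge18b_neg9 hb hs hbj hj1 hj7 hprime hp5 hwin hP hQ hQ4 hF1 hF2 h3 hcas]
  · push Not at h3
    exact pathAccounting_profile18b b j p hb hs hbj hj1 hj7 hprime hp5 hwin hfp hP hQ hQ4 h3 hcas

/-- **THE NODE ON THE WHOLE `N_p = 18` PROFILE (branch `(2,3)`), EVERY SORTED `b`: `PathAccountingFirstPeriod` with its binders VERBATIM plus `p ≤ b₇`,
`b₀ < p + b₂ + b₃`, `p + b₁ + b₄ ≤ b₀`** — gen 17's `pathAccountingFirstPeriod_profile18b` without the hypothesis `d < 3p`. -/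
theorem pathAccountingFirstPeriod_profile18b_all :
    ∀ (b : ℕ → ℤ) (p : ℕ), InPolytope b → Sorted7 b → InPolytope (shift b 7) →
      p.Prime → 5 ≤ p → (b 0 + 2 : ℤ) < (p : ℤ) ^ 2 → FirstPeriod b p →
      (p : ℤ) ≤ b 7 → b 0 < (p : ℤ) + b 2 + b 3 → (p : ℤ) + b 1 + b 4 ≤ b 0 → casoratian b 7 ≠ 0 →
        dOf b / (p : ℤ) - pairFloors b p - min (if 2 ≤ dOf b / (p : ℤ) then (1 : ℤ) else 0) (5 - (cStar b p : ℤ))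
          ≤ padicValRat p (casoratian b 7) :=
  fun b p hb hs hb7 hprime hp5 hwin hfp hP hQ hQ4 hcas =>
    pathAccounting_profile18b_all b 7 p hb hs hb7 (by norm_num) (by norm_num) hprime hp5 hwin hfp hP hQ hQ4 hcas

end Summit.KontsevichZagierPeriods.Zeta5Search.FullProfile
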